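import Summits.ValiantsHypothesis.ValiantsHypothesis.Theorems.SymPencilSdcPerFourCellNineSevenSplit
import Summits.ValiantsHypothesis.ValiantsHypothesis.Theorems.SymPencilPerFourIsotropicPairRank

/-!
# Route `SymPencil` — row `r = 11` of the size-`28` table, LEAF E AT FIVE SQUARES (core): a
# NON-TORUS hyperplane of `W_col(0,1;3)` carries no joint family of five squares
# (`--supports` stmt-ValiantsHypothesis-5674 `SdcSuperquadratic`; rung currency only)

At size `27` leaf E (`…SingFiveLeafWcol.wcolFive`) used the per-POINT rank `≤ 4` to force a
`5`-dimensional `W ⊆ W_col(p,q;m)` (rows `p,q` live, their column `m` zero) to be of torus type.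
With FIVE squares the per-point condition is empty.  Replacement (a radical-line argument, no
determinants): on `W₀ = W_col(0,1;3)` the `s²`-coefficient of `per_4 (u + s y)` along the base
points `u(t)` = «row 2 = (t, λ, μ), u₃₃ = 1» is `aᵀ M(t,λ,μ) b` (`a, b` = rows `0, 1` of `y`,
`M(w) = !![0,w₂,w₁; w₂,0,w₀; w₁,w₀,0]`).  Let `W = θ^⊥ ∩ W₀` with `θ = (θ_a, θ_b)`,
`k = (0, λ, −μ) = ker M(0,λ,μ)`, `A = θ_{a1}λ − θ_{a2}μ`, `B = θ_{b1}λ − θ_{b2}μ` both non-zero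
(NON-TORUS, after a column permutation).  At `t = 0` the form restricted to `W` has radical EXACTLY
the line `K r`, `r = (B k ; −A k) ∈ W`, while along `t` its value at `r` is `−2ABλμ·t` — a non-zero
LINEAR term.  A joint family `Σ_{k<5} c_k β_k(u,y)²` with all `c_k ≠ 0` forbids this
(`false_of_radical_line`: `y ↦ (β_k(u₀,y))_k` on the `5`-space `W` is either injective — then the
radical is `0` — or its kernel lies in the radical `K r`, so `β_k(u₀, r) = 0` and the value at `r`
is `O(t²)`).

* `false_of_radical_line` — the abstract obstruction;
* `per_wcol_line` — the permanent along the base points `u(t)`;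
* `noJointFive_wcol_core` — the normalised non-torus hyperplane (`θ`, `λ`, `μ` explicit, weights
  non-zero).  The wrapper (torus case via `…SingFiveBricksFive.torusDispatch_five`, zero weights
  via ✓ `noJointFamily_five_four`, the permutations) is the next file.

Honest framing: a lemma towards row `r = 11` (OPEN); nothing about the determinantal complexity of
`per_4` is claimed; stmt-5674 `SdcSuperquadratic` OPEN; `VP ≠ VNP` not moved.  No definitions, no
named facts. [folklore]
-/

noncomputable section

-- single-conjunct layout: Sub = Summit, duplicated namespace component intended
set_option linter.dupNamespace false

namespace Summit.ValiantsHypothesis.ValiantsHypothesis.Theorems.SymPencilPerFourWcolHyperplaneFiveCore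

open Matrix MvPolynomial Finset Module
open Literature.Computability.AlgebraicComplexity
open Summit.ValiantsHypothesis.ValiantsHypothesis.Theorems.SymPencilPerFourInnerRankRows
open Summit.ValiantsHypothesis.ValiantsHypothesis.Theorems.SymPencilSdcPerFourCellNineSevenSplit

universe u

variable {K : Type u} [Field K]

/-- **The radical-line obstruction.**  On a `5`-space, if `r ≠ 0` is radical for the weighted
polar form of `L₀` (weights non-zero) and the radical is contained in `K r`, then `L₀ r` pairs to
zero with `L₁ r`. [folklore] -/
theorem false_of_radical_line {V : Type*} [AddCommGroup V] [Module K V] [FiniteDimensional K V]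
    (hV : finrank K V = 5) (c : Fin 5 → K) (hc : ∀ k, c k ≠ 0) (L₀ L₁ : V →ₗ[K] (Fin 5 → K))
    (r : V) (hr : r ≠ 0) (hr0 : ∀ y' : V, ∑ k, c k * L₀ r k * L₀ y' k = 0)
    (hrad : ∀ y : V, (∀ y' : V, ∑ k, c k * L₀ y k * L₀ y' k = 0) → ∃ ν : K, y = ν • r)
    (hmix : ∑ k, c k * L₀ r k * L₁ r k ≠ 0) : False := by
  classical
  by_cases hinj : Function.Injective L₀
  · -- injective ⇒ surjective ⇒ `c_k (L₀ r)_k = 0` for every `k` ⇒ `L₀ r = 0` ⇒ `r = 0`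
    have hsurj : Function.Surjective L₀ := by
      rw [← LinearMap.range_eq_top]
      apply Submodule.eq_top_of_finrank_eq
      rw [LinearMap.finrank_range_of_inj hinj, hV, finrank_fintype_fun_eq_card, Fintype.card_fin]
    have hL0 : L₀ r = 0 := by
      funext k
      obtain ⟨y', hy'⟩ := hsurj (Pi.single k 1)
      have h := hr0 y'
      rw [hy', Finset.sum_eq_single k (fun k' _ hk' => by rw [Pi.single_eq_of_ne hk', mul_zero])
        (fun h => absurd (Finset.mem_univ k) h), Pi.single_eq_same, mul_one] at h
      exact (mul_eq_zero.1 h).resolve_left (hc k)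
    exact hr (hinj (by rw [hL0, map_zero]))
  · -- a non-zero kernel vector is radical, hence a multiple of `r`, hence `L₀ r = 0`
    have hker : LinearMap.ker L₀ ≠ ⊥ := by
      intro h; exact hinj (LinearMap.ker_eq_bot.1 h)
    obtain ⟨w, hw, hw0⟩ := Submodule.exists_mem_ne_zero_of_ne_bot hker
    rw [LinearMap.mem_ker] at hw
    obtain ⟨ν, hν⟩ := hrad w fun y' => by simp [hw]
    have hν0 : ν ≠ 0 := by rintro rfl; exact hw0 (by rw [hν, zero_smul])
    have hL0 : L₀ r = 0 := by
      have h : L₀ (ν • r) = 0 := by rw [← hν, hw]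
      rw [map_smul] at h
      exact (smul_eq_zero.1 h).resolve_left hν0
    apply hmix
    simp [hL0]

/-- **The permanent along the base points `u(t)`** (row `2 = (t, λ, μ)`, `u₃₃ = 1`) and a
direction `y` supported on rows `0,1`, columns `0,1,2`: `per_4 (u(t) + s y) = s² · aᵀ M(t,λ,μ) b`.
[folklore] -/
theorem per_wcol_line (t la mu : K) (u y : Fin 4 × Fin 4 → K)
    (hu : ∀ p : Fin 4 × Fin 4, u p = if p = (2, 0) then t else if p = (2, 1) then la
      else if p = (2, 2) then mu else if p = (3, 3) then 1 else 0)
    (hy2 : ∀ j, y (2, j) = 0) (hy3 : ∀ j, y (3, j) = 0) (hy03 : y (0, 3) = 0) (hy13 : y (1, 3) = 0)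
    (s : K) :
    eval (u + s • y) (perPoly (Fin 4) K) =
      s ^ 2 * (y (0, 0) * (mu * y (1, 1) + la * y (1, 2)) + y (0, 1) * (mu * y (1, 0) + t * y (1, 2)) +
        y (0, 2) * (la * y (1, 0) + t * y (1, 1))) := by
  rw [eval_perPoly]
  have hM : (Matrix.of fun i j => (u + s • y) (i, j)) =
      Matrix.of ![![s * y (0, 0), s * y (0, 1), s * y (0, 2), 0],
        ![s * y (1, 0), s * y (1, 1), s * y (1, 2), 0], ![t, la, mu, 0], ![0, 0, 0, 1]] := by
    ext i j
    fin_cases i <;> fin_cases j <;> simp +decide [hu, hy2, hy3, hy03, hy13]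
  rw [hM, permanent_of_rows]
  simp only [Matrix.cons_val_zero, Matrix.cons_val_one, Matrix.cons_val]
  ring

/-- ★ **Core: a normalised NON-TORUS hyperplane of `W_col(0,1;3)` carries no joint family of five
squares with non-zero weights.** [folklore] -/
theorem noJointFive_wcol_core [CharZero K] (W : Submodule K (Fin 4 × Fin 4 → K))
    (h5 : finrank K W = 5)
    (hW0 : ∀ x ∈ W, (∀ j, x (2, j) = 0) ∧ (∀ j, x (3, j) = 0) ∧ x (0, 3) = 0 ∧ x (1, 3) = 0)
    (θa θb : Fin 4 → K)
    (hWθ : ∀ x : Fin 4 × Fin 4 → K, (∀ j, x (2, j) = 0) → (∀ j, x (3, j) = 0) → x (0, 3) = 0 →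
      x (1, 3) = 0 → θa 0 * x (0, 0) + θa 1 * x (0, 1) + θa 2 * x (0, 2) +
        (θb 0 * x (1, 0) + θb 1 * x (1, 1) + θb 2 * x (1, 2)) = 0 → x ∈ W)
    (hθW : ∀ x ∈ W, θa 0 * x (0, 0) + θa 1 * x (0, 1) + θa 2 * x (0, 2) +
        (θb 0 * x (1, 0) + θb 1 * x (1, 1) + θb 2 * x (1, 2)) = 0)
    (la mu : K) (hla : la ≠ 0) (hmu : mu ≠ 0) (hA : θa 1 * la - θa 2 * mu ≠ 0)
    (hB : θb 1 * la - θb 2 * mu ≠ 0)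
    (c : Fin 5 → K) (hc : ∀ k, c k ≠ 0)
    (β : Fin 5 → ((Fin 4 × Fin 4 → K) →ₗ[K] (Fin 4 × Fin 4 → K) →ₗ[K] K))
    (hfam : ∀ u : Fin 4 × Fin 4 → K, ∀ y ∈ W, ∃ e₀ e₁ : K, ∀ s : K,
      eval (u + s • y) (perPoly (Fin 4) K) = e₀ + s * e₁ + s ^ 2 * ∑ k, c k * (β k u y) ^ 2) :
    False := by
  classical
  set A : K := θa 1 * la - θa 2 * mu with hAdef
  set B : K := θb 1 * la - θb 2 * mu with hBdef
  -- the base points `u(t) = u₀ + t • u₁`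
  obtain ⟨ul, hul⟩ : ∃ ul : K → (Fin 4 × Fin 4 → K), ∀ t p, ul t p = if p = (2, 0) then t
      else if p = (2, 1) then la else if p = (2, 2) then mu else if p = (3, 3) then 1 else 0 :=
    ⟨fun t p => if p = (2, 0) then t else if p = (2, 1) then la else if p = (2, 2) then mu
      else if p = (3, 3) then 1 else 0, fun _ _ => rfl⟩
  obtain ⟨u₁, hu₁⟩ : ∃ u₁ : Fin 4 × Fin 4 → K, ∀ p, u₁ p = if p = (2, 0) then 1 else 0 :=
    ⟨fun p => if p = (2, 0) then 1 else 0, fun _ => rfl⟩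
  have hline : ∀ t : K, ul t = ul 0 + t • u₁ := by
    intro t; funext p
    rw [Pi.add_apply, Pi.smul_apply, hul, hul, hu₁, smul_eq_mul]
    by_cases h : p = (2, 0)
    · simp [h]
    · simp [h]
  -- the quadratic form `q_t(y) = aᵀ M(t,λ,μ) b` and the five squares
  obtain ⟨q, hq⟩ : ∃ q : K → (Fin 4 × Fin 4 → K) → K, ∀ t y, q t y =
      y (0, 0) * (mu * y (1, 1) + la * y (1, 2)) + y (0, 1) * (mu * y (1, 0) + t * y (1, 2)) +
        y (0, 2) * (la * y (1, 0) + t * y (1, 1)) := ⟨_, fun _ _ => rfl⟩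
  have hsq : ∀ (t : K), ∀ y ∈ W, ∑ k, c k * (β k (ul t) y) ^ 2 = q t y := by
    intro t y hy
    obtain ⟨h2, h3, h03, h13⟩ := hW0 y hy
    obtain ⟨e₀, e₁, he⟩ := hfam (ul t) y hy
    have hz := quartic_coeffs_eq_zero e₀ e₁ (∑ k, c k * (β k (ul t) y) ^ 2 - q t y) 0 0
      fun s => by
        have h := he s
        rw [per_wcol_line t la mu (ul t) y (hul t) h2 h3 h03 h13 s] at h
        rw [hq]
        linear_combination -h
    exact sub_eq_zero.1 hz.2.2.1
  -- the maps `L₀, L₁ : W → K⁵`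
  obtain ⟨L₀, hL₀⟩ : ∃ L₀ : W →ₗ[K] (Fin 5 → K), ∀ (y : W) k, L₀ y k = β k (ul 0) y :=
    ⟨LinearMap.pi fun k => (β k (ul 0)).comp W.subtype, fun _ _ => rfl⟩
  obtain ⟨L₁, hL₁⟩ : ∃ L₁ : W →ₗ[K] (Fin 5 → K), ∀ (y : W) k, L₁ y k = β k u₁ y :=
    ⟨LinearMap.pi fun k => (β k u₁).comp W.subtype, fun _ _ => rfl⟩
  -- polar form at `t = 0`
  have hpol : ∀ y y' : W, ∑ k, c k * L₀ y k * L₀ y' k =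
      2⁻¹ * (q 0 ((y : Fin 4 × Fin 4 → K) + y') - q 0 y - q 0 y') := by
    intro y y'
    have h := hsq 0 _ (W.add_mem y.2 y'.2)
    have hy := hsq 0 _ y.2
    have hy' := hsq 0 _ y'.2
    simp only [map_add] at h
    have e : ∑ k, c k * L₀ y k * L₀ y' k = 2⁻¹ * (∑ k, c k * (β k (ul 0) y + β k (ul 0) y') ^ 2 -
        ∑ k, c k * (β k (ul 0) y) ^ 2 - ∑ k, c k * (β k (ul 0) y') ^ 2) := by
      rw [← Finset.sum_sub_distrib, ← Finset.sum_sub_distrib, Finset.mul_sum]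
      exact Finset.sum_congr rfl fun k _ => by rw [hL₀, hL₀]; ring
    rw [e, h, hy, hy']
  -- the radical vector `r = (B k ; -A k)`, `k = (0, λ, -μ)`
  obtain ⟨rv, hrv⟩ : ∃ rv : Fin 4 × Fin 4 → K, ∀ p, rv p =
      if p = (0, 1) then B * la else if p = (0, 2) then -(B * mu) else if p = (1, 1) then -(A * la)
      else if p = (1, 2) then A * mu else 0 := ⟨_, fun _ => rfl⟩
  have ev : ∀ i j : Fin 4, rv (i, j) = if (i, j) = ((0 : Fin 4), (1 : Fin 4)) then B * la
      else if (i, j) = ((0 : Fin 4), (2 : Fin 4)) then -(B * mu)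
      else if (i, j) = ((1 : Fin 4), (1 : Fin 4)) then -(A * la)
      else if (i, j) = ((1 : Fin 4), (2 : Fin 4)) then A * mu else 0 := fun i j => hrv (i, j)
  have hrvW : rv ∈ W := by
    apply hWθ <;> simp +decide [ev]
    ring
  set r : W := ⟨rv, hrvW⟩ with hrdef
  have hr : r ≠ 0 := by
    intro h
    have h01 : rv (0, 1) = 0 := by
      have := congrArg (fun z : W => (z : Fin 4 × Fin 4 → K) (0, 1)) h
      simpa [hrdef] using this
    simp +decide [ev] at h01
    rcases h01 with h | h
    · exact hB h
    · exact hla h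
  -- `r` is radical
  have hr0 : ∀ y' : W, ∑ k, c k * L₀ r k * L₀ y' k = 0 := by
    intro y'
    rw [hpol, hq, hq, hq]
    simp +decide [Pi.add_apply, hrdef, ev]
    ring
  -- the radical is exactly `K r`
  have hrad : ∀ y : W, (∀ y' : W, ∑ k, c k * L₀ y k * L₀ y' k = 0) → ∃ ν : K, y = ν • r := by
    intro y hy
    obtain ⟨h2, h3, h03, h13⟩ := hW0 _ y.2
    have hθy := hθW _ y.2
    -- test vectors in `W`
    have test : ∀ v : Fin 4 × Fin 4 → K, ∀ hv : v ∈ W,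
        q 0 ((y : Fin 4 × Fin 4 → K) + v) - q 0 y - q 0 v = 0 := by
      intro v hv
      have h := hy ⟨v, hv⟩
      rw [hpol] at h
      have h2' : (2⁻¹ : K) ≠ 0 := inv_ne_zero two_ne_zero
      exact (mul_eq_zero.1 h).resolve_left h2'
    -- T₁ = (A, -θa0 λ, θa0 μ ; 0), T₂ = (0, θa2, -θa1 ; 0), T₁' , T₂' on row 1
    obtain ⟨T1, hT1⟩ : ∃ v : Fin 4 × Fin 4 → K, ∀ p, v p = if p = (0, 0) then A
        else if p = (0, 1) then -(θa 0 * la) else if p = (0, 2) then θa 0 * mu else 0 :=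
      ⟨_, fun _ => rfl⟩
    obtain ⟨T2, hT2⟩ : ∃ v : Fin 4 × Fin 4 → K, ∀ p, v p = if p = (0, 1) then θa 2
        else if p = (0, 2) then -θa 1 else 0 := ⟨_, fun _ => rfl⟩
    obtain ⟨S1, hS1⟩ : ∃ v : Fin 4 × Fin 4 → K, ∀ p, v p = if p = (1, 0) then B
        else if p = (1, 1) then -(θb 0 * la) else if p = (1, 2) then θb 0 * mu else 0 :=
      ⟨_, fun _ => rfl⟩
    obtain ⟨S2, hS2⟩ : ∃ v : Fin 4 × Fin 4 → K, ∀ p, v p = if p = (1, 1) then θb 2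
        else if p = (1, 2) then -θb 1 else 0 := ⟨_, fun _ => rfl⟩
    have eT1 : ∀ i j : Fin 4, T1 (i, j) = if (i, j) = ((0 : Fin 4), (0 : Fin 4)) then A
        else if (i, j) = ((0 : Fin 4), (1 : Fin 4)) then -(θa 0 * la)
        else if (i, j) = ((0 : Fin 4), (2 : Fin 4)) then θa 0 * mu else 0 := fun i j => hT1 (i, j)
    have eT2 : ∀ i j : Fin 4, T2 (i, j) = if (i, j) = ((0 : Fin 4), (1 : Fin 4)) then θa 2
        else if (i, j) = ((0 : Fin 4), (2 : Fin 4)) then -θa 1 else 0 := fun i j => hT2 (i, j)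
    have eS1 : ∀ i j : Fin 4, S1 (i, j) = if (i, j) = ((1 : Fin 4), (0 : Fin 4)) then B
        else if (i, j) = ((1 : Fin 4), (1 : Fin 4)) then -(θb 0 * la)
        else if (i, j) = ((1 : Fin 4), (2 : Fin 4)) then θb 0 * mu else 0 := fun i j => hS1 (i, j)
    have eS2 : ∀ i j : Fin 4, S2 (i, j) = if (i, j) = ((1 : Fin 4), (1 : Fin 4)) then θb 2
        else if (i, j) = ((1 : Fin 4), (2 : Fin 4)) then -θb 1 else 0 := fun i j => hS2 (i, j)
    have hT1W : T1 ∈ W := by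
      apply hWθ <;> simp +decide [eT1]
      rw [hAdef]; ring
    have hT2W : T2 ∈ W := by
      apply hWθ <;> simp +decide [eT2]
      ring
    have hS1W : S1 ∈ W := by
      apply hWθ <;> simp +decide [eS1]
      rw [hBdef]; ring
    have hS2W : S2 ∈ W := by
      apply hWθ <;> simp +decide [eS2]
      ring
    have g1 := test T1 hT1W
    have g2 := test T2 hT2W
    have g3 := test S1 hS1W
    have g4 := test S2 hS2W
    simp +decide only [hq, Pi.add_apply, eT1, eT2, eS1, eS2, if_true, if_false, add_zero,
      mul_zero, zero_mul] at g1 g2 g3 g4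
    -- consequences: `b₀ = 0`, `μ b₁ + λ b₂ = 0`, `a₀ = 0`, `μ a₁ + λ a₂ = 0`
    set a0 := (y : Fin 4 × Fin 4 → K) (0, 0) with ha0
    set a1 := (y : Fin 4 × Fin 4 → K) (0, 1) with ha1
    set a2 := (y : Fin 4 × Fin 4 → K) (0, 2) with ha2
    set b0 := (y : Fin 4 × Fin 4 → K) (1, 0) with hb0
    set b1 := (y : Fin 4 × Fin 4 → K) (1, 1) with hb1
    set b2 := (y : Fin 4 × Fin 4 → K) (1, 2) with hb2
    have kb : mu * b1 + la * b2 = 0 := by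
      have h : A * (mu * b1 + la * b2) = 0 := by linear_combination g1
      exact (mul_eq_zero.1 h).resolve_left hA
    have kb0 : b0 = 0 := by
      have h : A * b0 = 0 := by rw [hAdef]; linear_combination -g2
      exact (mul_eq_zero.1 h).resolve_left hA
    have ka : mu * a1 + la * a2 = 0 := by
      have h : B * (mu * a1 + la * a2) = 0 := by linear_combination g3
      exact (mul_eq_zero.1 h).resolve_left hB
    have ka0 : a0 = 0 := by
      have h : B * a0 = 0 := by rw [hBdef]; linear_combination -g4
      exact (mul_eq_zero.1 h).resolve_left hB
    -- the hyperplane equation then reads `a₁ A + b₁ B = 0` (times `λ⁻¹`)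
    have hθ' : a1 * A + b1 * B = 0 := by
      have h := hθy
      rw [ka0, kb0] at h
      rw [hAdef, hBdef]
      linear_combination la * h - θa 2 * ka - θb 2 * kb
    refine ⟨-(b1 / (A * la)), Subtype.ext ?_⟩
    funext p
    rw [Submodule.coe_smul, Pi.smul_apply, smul_eq_mul]
    change (y : Fin 4 × Fin 4 → K) p = -(b1 / (A * la)) * rv p
    obtain ⟨i, j⟩ := p
    rw [ev]
    fin_cases i <;> fin_cases j <;> simp +decide
    · exact ka0
    · change a1 = _
      field_simp
      linear_combination hθ'
    · change a2 = _
      field_simp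
      linear_combination -(mu * hθ') + A * ka
    · exact h03
    · exact kb0
    · change b1 = _
      field_simp
    · change b2 = _
      field_simp
      linear_combination kb
    · exact h13
    · exact h2 0
    · exact h2 1
    · exact h2 2
    · exact h2 3
    · exact h3 0
    · exact h3 1
    · exact h3 2
    · exact h3 3
  -- the mixed term: `Σ c_k (L₀ r + t L₁ r)_k² = q t r = -2ABλμ · t`
  have hmix : ∑ k, c k * L₀ r k * L₁ r k ≠ 0 := by
    have hval : ∀ t : K, ∑ k, c k * (L₀ r k + t * L₁ r k) ^ 2 = 2 * A * B * la * mu * t := by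
      intro t
      have h := hsq t rv hrvW
      rw [hline t] at h
      simp only [map_add, map_smul, LinearMap.add_apply, LinearMap.smul_apply, smul_eq_mul] at h
      have e : ∑ k, c k * (L₀ r k + t * L₁ r k) ^ 2 =
          ∑ k, c k * (β k (ul 0) rv + t * β k u₁ rv) ^ 2 :=
        Finset.sum_congr rfl fun k _ => by rw [hL₀, hL₁]
      rw [e, h, hq]
      simp +decide [ev]
      ring
    have h1 := hval 1
    have h2 := hval (-1)
    have e : ∑ k, c k * L₀ r k * L₁ r k = 4⁻¹ * (∑ k, c k * (L₀ r k + 1 * L₁ r k) ^ 2 -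
        ∑ k, c k * (L₀ r k + (-1) * L₁ r k) ^ 2) := by
      rw [← Finset.sum_sub_distrib, Finset.mul_sum]
      exact Finset.sum_congr rfl fun k _ => by ring
    rw [e, h1, h2]
    have : (4⁻¹ : K) * (2 * A * B * la * mu * 1 - 2 * A * B * la * mu * -1) =
        A * B * la * mu := by ring
    rw [this]
    exact mul_ne_zero (mul_ne_zero (mul_ne_zero hA hB) hla) hmu
  exact false_of_radical_line h5 c hc L₀ L₁ r hr hr0 hrad hmix

end Summit.ValiantsHypothesis.ValiantsHypothesis.Theorems.SymPencilPerFourWcolHyperplaneFiveCore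

end
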